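import Summits.KontsevichZagierPeriods.KontsevichZagierPeriods.Theorems.LinRedNormalFormArrangementNormalFormSeparateTwoAngular

/-!
# Order reductions and local mass for weights in three blown-up variables

(Line `janus-bands`, crux `ArrangementNormalForm`, stub `stub_separateHigh`, part `HHKOrder` of
the wall-invariant termwise-split lemma `separateThree_hHk` in base dimension `3` with fibres.)
On a nested thin sector at a base point of `ℝ³` the weight `W(t, v, u)` (scalar chart factor
times the fibre mass) has LOGARITHMIC CONTRACTION COSTS in some of the variables
(`W(·, u) ≤ C (1 + log (u'/u))^K W(·, u')`, parts `HHKMass`, `CornerLog`). This file turns the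
output of the three-variable monomial split (part `HHKMonoSplit`: one monomial `t^a v^b u^c` is
`W`-integrable) into the three forms consumed by the ray theorems:
* `reduce_u` — with a cost in `u`, `t^a v^b` is `W`-integrable (the pieces at a direction of the
  pole plane are `O(t^a v^b)`);
* `reduce_v`, `reduce_t` — the same in `v` and in `t`;
* `mass_lt_top₃` (registered as `separateThreeHHK_order`) — with costs in all three variables,
  `W` itself is integrable near the corner (the pieces at a point off the pole plane are bounded).
The one-variable input is `SepTwo.lintegral_le_pow_of_logmono` of part `Angular`.
-/

noncomputable section

open Set MeasureTheory
open scoped ENNReal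

namespace Summit.KontsevichZagierPeriods.ArrangementNormalForm.JanusBands

namespace SepHHK

open SepTwo

variable (W : ℝ → ℝ → ℝ → ℝ≥0∞)

/-- Sections of a jointly measurable weight. -/
theorem measurable_secU (hW : Measurable fun p : ℝ × ℝ × ℝ => W p.1 p.2.1 p.2.2) (t v : ℝ) :
    Measurable fun u => W t v u :=
  hW.comp (measurable_const.prodMk (measurable_const.prodMk measurable_id))

/-- Sections of a jointly measurable weight. -/
theorem measurable_secVU (hW : Measurable fun p : ℝ × ℝ × ℝ => W p.1 p.2.1 p.2.2) (t : ℝ) :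
    Measurable (Function.uncurry fun v u => W t v u) :=
  hW.comp (measurable_const.prodMk measurable_id)

/-- The inner `u`-integral is jointly measurable in `(t, v)`. -/
theorem measurable_intU (hW : Measurable fun p : ℝ × ℝ × ℝ => W p.1 p.2.1 p.2.2) (S : Set ℝ) :
    Measurable (Function.uncurry fun t v => ∫⁻ u in S, W t v u) := by
  have h : Measurable fun q : (ℝ × ℝ) × ℝ => W q.1.1 q.1.2 q.2 :=
    hW.comp ((measurable_fst.comp measurable_fst).prodMk
      ((measurable_snd.comp measurable_fst).prodMk measurable_snd))
  exact h.lintegral_prod_right'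

/-- The constant of the one-variable order reduction. -/
def ordC (C : ℝ≥0∞) (Kn : ℕ) (ρ : ℝ) (c : ℕ) : ℝ≥0∞ :=
  (C * ENNReal.ofReal (4 * (1 + 2 * Kn) ^ Kn) + 1) * ENNReal.ofReal ((2 / ρ) ^ c)

/-- The constant is finite. -/
theorem ordC_ne_top {C : ℝ≥0∞} (hC : C ≠ ∞) (Kn : ℕ) (ρ : ℝ) (c : ℕ) : ordC C Kn ρ c ≠ ∞ :=
  ENNReal.mul_ne_top (ENNReal.add_ne_top.2
    ⟨ENNReal.mul_ne_top hC ENNReal.ofReal_ne_top, ENNReal.one_ne_top⟩) ENNReal.ofReal_ne_top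

/-- **Order reduction in `u`.** -/
theorem reduce_u (hW : Measurable fun p : ℝ × ℝ × ℝ => W p.1 p.2.1 p.2.2) (Kn : ℕ) (C : ℝ≥0∞)
    (hC : C ≠ ∞) {δ ε η : ℝ} (hη : 0 < η)
    (hulog : ∀ t, 0 < t → t < δ → ∀ v, 0 < v → v < ε → ∀ u u', 0 < u → u ≤ u' → u' < η →
      W t v u ≤ C * ENNReal.ofReal ((1 + Real.log (u' / u)) ^ Kn) * W t v u')
    (a b c : ℕ)
    (hfin : ∫⁻ t in Ioo 0 δ, ∫⁻ v in Ioo 0 ε, ∫⁻ u in Ioo 0 η,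
      ENNReal.ofReal (t ^ a * v ^ b * u ^ c) * W t v u < ∞) :
    ∫⁻ t in Ioo 0 δ, ∫⁻ v in Ioo 0 ε, ∫⁻ u in Ioo 0 η,
      ENNReal.ofReal (t ^ a * v ^ b) * W t v u < ∞ := by
  have hAne := ordC_ne_top hC Kn η c
  have hm := measurable_secU W hW
  have h1 : ∀ t ∈ Ioo (0 : ℝ) δ, ∀ v ∈ Ioo (0 : ℝ) ε, ∫⁻ u in Ioo 0 η, W t v u ≤
      ordC C Kn η c * ∫⁻ u in Ioo 0 η, ENNReal.ofReal (u ^ c) * W t v u := fun t ht v hv =>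
    lintegral_le_pow_of_logmono (W t v) (hm t v) Kn C hη
      (fun u u' hu huu' hu' => hulog t ht.1 ht.2 v hv.1 hv.2 u u' hu huu' hu') c
  calc ∫⁻ t in Ioo 0 δ, ∫⁻ v in Ioo 0 ε, ∫⁻ u in Ioo 0 η, ENNReal.ofReal (t ^ a * v ^ b) * W t v u
      = ∫⁻ t in Ioo 0 δ, ∫⁻ v in Ioo 0 ε, ENNReal.ofReal (t ^ a * v ^ b) * ∫⁻ u in Ioo 0 η, W t v u :=
        lintegral_congr fun t => lintegral_congr fun v => lintegral_const_mul _ (hm t v)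
    _ ≤ ∫⁻ t in Ioo 0 δ, ∫⁻ v in Ioo 0 ε, ENNReal.ofReal (t ^ a * v ^ b) *
          (ordC C Kn η c * ∫⁻ u in Ioo 0 η, ENNReal.ofReal (u ^ c) * W t v u) :=
        setLIntegral_mono' measurableSet_Ioo fun t ht => setLIntegral_mono' measurableSet_Ioo
          fun v hv => mul_le_mul_right (h1 t ht v hv) _
    _ = ordC C Kn η c * ∫⁻ t in Ioo 0 δ, ∫⁻ v in Ioo 0 ε, ∫⁻ u in Ioo 0 η,
          ENNReal.ofReal (t ^ a * v ^ b * u ^ c) * W t v u := by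
        rw [← lintegral_const_mul' _ _ hAne]
        refine setLIntegral_congr_fun measurableSet_Ioo fun t ht => ?_
        rw [← lintegral_const_mul' _ _ hAne]
        refine setLIntegral_congr_fun measurableSet_Ioo fun v hv => ?_
        have hmu : Measurable fun u => ENNReal.ofReal (u ^ c) * W t v u :=
          (ENNReal.measurable_ofReal.comp (measurable_id.pow_const c)).mul (hm t v)
        rw [mul_left_comm, ← lintegral_const_mul _ hmu]
        congr 1
        refine lintegral_congr fun u => ?_
        rw [← mul_assoc, ← ENNReal.ofReal_mul (mul_nonneg (pow_nonneg ht.1.le _) (pow_nonneg hv.1.le _))]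
    _ < ∞ := ENNReal.mul_lt_top hAne.lt_top hfin

/-- **Order reduction in `v`.** -/
theorem reduce_v (hW : Measurable fun p : ℝ × ℝ × ℝ => W p.1 p.2.1 p.2.2) (Kn : ℕ) (C : ℝ≥0∞)
    (hC : C ≠ ∞) {δ ε η : ℝ} (hε : 0 < ε)
    (hvlog : ∀ t, 0 < t → t < δ → ∀ u, 0 < u → u < η → ∀ v v', 0 < v → v ≤ v' → v' < ε →
      W t v u ≤ C * ENNReal.ofReal ((1 + Real.log (v' / v)) ^ Kn) * W t v' u)
    (a b : ℕ)
    (hfin : ∫⁻ t in Ioo 0 δ, ∫⁻ v in Ioo 0 ε, ∫⁻ u in Ioo 0 η,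
      ENNReal.ofReal (t ^ a * v ^ b) * W t v u < ∞) :
    ∫⁻ t in Ioo 0 δ, ∫⁻ v in Ioo 0 ε, ∫⁻ u in Ioo 0 η, ENNReal.ofReal (t ^ a) * W t v u < ∞ := by
  have hAne := ordC_ne_top hC Kn ε b
  have hm := measurable_secU W hW
  set g : ℝ → ℝ → ℝ≥0∞ := fun t v => ∫⁻ u in Ioo 0 η, W t v u with hg
  have hgm : ∀ t, Measurable (g t) := fun t => (measurable_secVU W hW t).lintegral_prod_right'
  have hgcost : ∀ t ∈ Ioo (0 : ℝ) δ, ∀ v v', 0 < v → v ≤ v' → v' < ε →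
      g t v ≤ C * ENNReal.ofReal ((1 + Real.log (v' / v)) ^ Kn) * g t v' := by
    intro t ht v v' hv hvv' hv'
    simp only [hg]
    rw [← lintegral_const_mul' _ _ (ENNReal.mul_ne_top hC ENNReal.ofReal_ne_top)]
    exact setLIntegral_mono' measurableSet_Ioo fun u hu =>
      hvlog t ht.1 ht.2 u hu.1 hu.2 v v' hv hvv' hv'
  have h1 : ∀ t ∈ Ioo (0 : ℝ) δ, ∫⁻ v in Ioo 0 ε, g t v ≤
      ordC C Kn ε b * ∫⁻ v in Ioo 0 ε, ENNReal.ofReal (v ^ b) * g t v := fun t ht =>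
    lintegral_le_pow_of_logmono (g t) (hgm t) Kn C hε (hgcost t ht) b
  have hmv : ∀ t, Measurable fun v => ENNReal.ofReal (v ^ b) * g t v := fun t =>
    (ENNReal.measurable_ofReal.comp (measurable_id.pow_const b)).mul (hgm t)
  calc ∫⁻ t in Ioo 0 δ, ∫⁻ v in Ioo 0 ε, ∫⁻ u in Ioo 0 η, ENNReal.ofReal (t ^ a) * W t v u
      = ∫⁻ t in Ioo 0 δ, ENNReal.ofReal (t ^ a) * ∫⁻ v in Ioo 0 ε, g t v := by
        refine lintegral_congr fun t => ?_
        rw [← lintegral_const_mul _ (hgm t)]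
        exact lintegral_congr fun v => lintegral_const_mul _ (hm t v)
    _ ≤ ∫⁻ t in Ioo 0 δ, ENNReal.ofReal (t ^ a) *
          (ordC C Kn ε b * ∫⁻ v in Ioo 0 ε, ENNReal.ofReal (v ^ b) * g t v) :=
        setLIntegral_mono' measurableSet_Ioo fun t ht => mul_le_mul_right (h1 t ht) _
    _ = ordC C Kn ε b * ∫⁻ t in Ioo 0 δ, ∫⁻ v in Ioo 0 ε, ∫⁻ u in Ioo 0 η,
          ENNReal.ofReal (t ^ a * v ^ b) * W t v u := by
        rw [← lintegral_const_mul' _ _ hAne]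
        refine setLIntegral_congr_fun measurableSet_Ioo fun t ht => ?_
        rw [mul_left_comm, ← lintegral_const_mul _ (hmv t)]
        congr 1
        refine lintegral_congr fun v => ?_
        rw [← mul_assoc, ← ENNReal.ofReal_mul (pow_nonneg ht.1.le _)]
        exact (lintegral_const_mul _ (hm t v)).symm
    _ < ∞ := ENNReal.mul_lt_top hAne.lt_top hfin

/-- **Order reduction in `t`.** -/
theorem reduce_t (hW : Measurable fun p : ℝ × ℝ × ℝ => W p.1 p.2.1 p.2.2) (Kn : ℕ) (C : ℝ≥0∞)
    (hC : C ≠ ∞) {δ ε η : ℝ} (hδ : 0 < δ)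
    (htlog : ∀ v, 0 < v → v < ε → ∀ u, 0 < u → u < η → ∀ t t', 0 < t → t ≤ t' → t' < δ →
      W t v u ≤ C * ENNReal.ofReal ((1 + Real.log (t' / t)) ^ Kn) * W t' v u)
    (a : ℕ)
    (hfin : ∫⁻ t in Ioo 0 δ, ∫⁻ v in Ioo 0 ε, ∫⁻ u in Ioo 0 η, ENNReal.ofReal (t ^ a) * W t v u < ∞) :
    ∫⁻ t in Ioo 0 δ, ∫⁻ v in Ioo 0 ε, ∫⁻ u in Ioo 0 η, W t v u < ∞ := by
  have hAne := ordC_ne_top hC Kn δ a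
  have hm := measurable_secU W hW
  set g : ℝ → ℝ≥0∞ := fun t => ∫⁻ v in Ioo 0 ε, ∫⁻ u in Ioo 0 η, W t v u with hg
  have hgi : ∀ t, Measurable fun v => ∫⁻ u in Ioo 0 η, W t v u := fun t =>
    (measurable_secVU W hW t).lintegral_prod_right'
  have hgm : Measurable g := (measurable_intU W hW (Ioo 0 η)).lintegral_prod_right'
  have hgcost : ∀ t t', 0 < t → t ≤ t' → t' < δ →
      g t ≤ C * ENNReal.ofReal ((1 + Real.log (t' / t)) ^ Kn) * g t' := by
    intro t t' ht htt' ht'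
    simp only [hg]
    rw [← lintegral_const_mul' _ _ (ENNReal.mul_ne_top hC ENNReal.ofReal_ne_top)]
    refine setLIntegral_mono' measurableSet_Ioo fun v hv => ?_
    rw [← lintegral_const_mul' _ _ (ENNReal.mul_ne_top hC ENNReal.ofReal_ne_top)]
    exact setLIntegral_mono' measurableSet_Ioo fun u hu =>
      htlog v hv.1 hv.2 u hu.1 hu.2 t t' ht htt' ht'
  have h1 : ∫⁻ t in Ioo 0 δ, g t ≤ ordC C Kn δ a * ∫⁻ t in Ioo 0 δ, ENNReal.ofReal (t ^ a) * g t :=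
    lintegral_le_pow_of_logmono g hgm Kn C hδ hgcost a
  calc ∫⁻ t in Ioo 0 δ, ∫⁻ v in Ioo 0 ε, ∫⁻ u in Ioo 0 η, W t v u = ∫⁻ t in Ioo 0 δ, g t := rfl
    _ ≤ ordC C Kn δ a * ∫⁻ t in Ioo 0 δ, ENNReal.ofReal (t ^ a) * g t := h1
    _ = ordC C Kn δ a * ∫⁻ t in Ioo 0 δ, ∫⁻ v in Ioo 0 ε, ∫⁻ u in Ioo 0 η,
          ENNReal.ofReal (t ^ a) * W t v u := by
        congr 1
        refine lintegral_congr fun t => ?_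
        rw [hg]
        dsimp only
        rw [← lintegral_const_mul _ (hgi t)]
        exact lintegral_congr fun v => (lintegral_const_mul _ (hm t v)).symm
    _ < ∞ := ENNReal.mul_lt_top hAne.lt_top hfin

/-- **Local mass from three logarithmic costs and one monomial.** -/
theorem mass_lt_top₃ (hW : Measurable fun p : ℝ × ℝ × ℝ => W p.1 p.2.1 p.2.2) (Kn : ℕ)
    (C : ℝ≥0∞) (hC : C ≠ ∞) {δ ε η : ℝ} (hδ : 0 < δ) (hε : 0 < ε) (hη : 0 < η)
    (htlog : ∀ v, 0 < v → v < ε → ∀ u, 0 < u → u < η → ∀ t t', 0 < t → t ≤ t' → t' < δ →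
      W t v u ≤ C * ENNReal.ofReal ((1 + Real.log (t' / t)) ^ Kn) * W t' v u)
    (hvlog : ∀ t, 0 < t → t < δ → ∀ u, 0 < u → u < η → ∀ v v', 0 < v → v ≤ v' → v' < ε →
      W t v u ≤ C * ENNReal.ofReal ((1 + Real.log (v' / v)) ^ Kn) * W t v' u)
    (hulog : ∀ t, 0 < t → t < δ → ∀ v, 0 < v → v < ε → ∀ u u', 0 < u → u ≤ u' → u' < η →
      W t v u ≤ C * ENNReal.ofReal ((1 + Real.log (u' / u)) ^ Kn) * W t v u')
    (a b c : ℕ)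
    (hfin : ∫⁻ t in Ioo 0 δ, ∫⁻ v in Ioo 0 ε, ∫⁻ u in Ioo 0 η,
      ENNReal.ofReal (t ^ a * v ^ b * u ^ c) * W t v u < ∞) :
    ∫⁻ t in Ioo 0 δ, ∫⁻ v in Ioo 0 ε, ∫⁻ u in Ioo 0 η, W t v u < ∞ :=
  reduce_t W hW Kn C hC hδ htlog a
    (reduce_v W hW Kn C hC hε hvlog a b (reduce_u W hW Kn C hC hη hulog a b c hfin))

end SepHHK

/-- **Local integrability of a weight with three logarithmic contraction costs** (registered part
of `stub_separateHigh`, base dimension `3` with fibres; literal form of `SepHHK.mass_lt_top₃`): a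
jointly measurable weight on `(0, δ) × (0, ε) × (0, η)` with logarithmic contraction costs in each
of the three variables which integrates one monomial `t^a v^b u^c` (iterated lower integrals) is
integrable. -/
theorem separateThreeHHK_order (W : ℝ → ℝ → ℝ → ENNReal) (hW : Measurable fun p : ℝ × ℝ × ℝ => W p.1 p.2.1 p.2.2) (Kn : ℕ) (C : ENNReal) (hC : C ≠ ⊤) (δ ε η : ℝ) (hδ : 0 < δ) (hε : 0 < ε) (hη : 0 < η) (htlog : ∀ v : ℝ, 0 < v → v < ε → ∀ u : ℝ, 0 < u → u < η → ∀ t t' : ℝ, 0 < t → t ≤ t' → t' < δ → W t v u ≤ C * ENNReal.ofReal ((1 + Real.log (t' / t)) ^ Kn) * W t' v u) (hvlog : ∀ t : ℝ, 0 < t → t < δ → ∀ u : ℝ, 0 < u → u < η → ∀ v v' : ℝ, 0 < v → v ≤ v' → v' < ε → W t v u ≤ C * ENNReal.ofReal ((1 + Real.log (v' / v)) ^ Kn) * W t v' u) (hulog : ∀ t : ℝ, 0 < t → t < δ → ∀ v : ℝ, 0 < v → v < ε → ∀ u u' : ℝ, 0 < u → u ≤ u' → u' < η → W t v u ≤ C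 * ENNReal.ofReal ((1 + Real.log (u' / u)) ^ Kn) * W t v u') (a b c : ℕ) (hfin : MeasureTheory.lintegral (MeasureTheory.volume.restrict (Set.Ioo 0 δ)) (fun t => MeasureTheory.lintegral (MeasureTheory.volume.restrict (Set.Ioo 0 ε)) (fun v => MeasureTheory.lintegral (MeasureTheory.volume.restrict (Set.Ioo 0 η)) (fun u => ENNReal.ofReal (t ^ a * v ^ b * u ^ c) * W t v u))) < ⊤) : MeasureTheory.lintegral (MeasureTheory.volume.restrict (Set.Ioo 0 δ)) (fun t => MeasureTheory.lintegral (MeasureTheory.volume.restrict (Set.Ioo 0 ε)) (fun v => MeasureTheory.lintegral (MeasureTheory.volume.restrict (Set.Ioo 0 η)) (fun u => W t v u))) < ⊤ := by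
  exact SepHHK.mass_lt_top₃ W hW Kn C hC hδ hε hη htlog hvlog hulog a b c hfin

end Summit.KontsevichZagierPeriods.ArrangementNormalForm.JanusBands
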